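import Literature.NumberTheory.LFunctions.LogFreeDensityDHTheorem14
import HarnessLib

/-!
# RH family, wave 0 — proofs: the Deuring–Heilbronn phenomenon (rh.S33), discharged

Topic `Literature/NumberTheory/LFunctions`. Sibling proof file of `RHWave0.lean` (theorems only: no
definition, no named fact, no `sorry`) for the named fact
`Literature.NumberTheory.LFunctions.deuring_heilbronn` (**rh.S33**; Linnik 1944, in Bombieri's
normalisation): there are absolute `c₁, c₂ > 0` such that if `χ₁` is a real character mod `q` with
a real zero `β₁ < 1` of `L(s, χ₁)`, then every zero `ρ = σ + it ≠ β₁`, `0 < σ < 1`, of any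
`L(s, χ)`, `χ` mod `q`, has `σ ≤ 1 − c₂ log(c₁ / ((1 − β₁) log(q(2 + |t|)))) / log(q(2 + |t|))`.
`RHWave0.lean` cannot import the proof (it is imported by it), hence this file.

## Proof architecture (Bombieri, *Le grand crible*, §6, Théorème 14, second assertion)

* `Literature.NumberTheory.LFunctions.LogFreeDensity.logFreeDensityDH`
  (`LogFreeDensityDHTheorem14.lean`) is Bombieri's THÉORÈME 14, second assertion — the log-free
  zero-density estimate with the exceptional-zero factor,
  `N(α, T; χ, β₁ excluded) ≤ C ((1 − β₁) log T) T^{c₂(1−α)}` for every primitive `χ ≠ χ₀` of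
  modulus `≤ T` and for the zeros of `ζ` (`q = 1`), `1/2 ≤ α ≤ 1`, whenever `β₁` is a real zero of
  a real primitive `χ₁ ≠ χ₀` of modulus `≤ T` with `(1 − β₁) log T ≤ c₁` — proved in the tree from
  Gallagher's form of the large sieve (`LogFreeDensityMeanValueW.lean`), Turán's lemma
  (`LogFreeDensityLemmaA.lean`, `LogFreeDensityDHZeroSide*.lean`), the three-term identities of
  the function `F` built on `ψ = χχ₁` (`LogFreeDensityDHLemmaB.lean`), Lemme C via the
  Tao–Teräväinen exceptional-prime bound (`LogFreeDensityDHLemmaC.lean`), the classical zero-free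
  region with the theorems of Landau and Page, and Siegel's theorem.
* `Literature.NumberTheory.LFunctions.deuring_heilbronn_of_logFreeDensityDH_half`
  (`DeuringHeilbronnFromDensity.lean`) is the one-zero specialisation: that density estimate
  implies `deuring_heilbronn` (reduction to the inducing primitive character; `T = q(2 + |t|)`;
  zeros with `σ < 1/2` by Siegel's bound). [cite: IwaniecConversations2006, §9 (9.5)–(9.6)]

## References

* E. Bombieri, *Le grand crible dans la théorie analytique des nombres*, Astérisque 18 (2ᵉ éd.
  1987), §6, Théorème 14 and its proof, pp. 43–52. [Bombieri1987GrandCrible]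
* Yu. V. Linnik, *On the least prime in an arithmetic progression II. The Deuring–Heilbronn
  phenomenon*, Mat. Sb. 15 (57) (1944), 347–368. [Linnik1944]
* H. Iwaniec, *Conversations on the exceptional character*, Lecture Notes in Math. 1891 (2006), §9.
  [IwaniecConversations2006]
-/

noncomputable section

namespace Literature.NumberTheory.LFunctions

/-- **rh.S33, discharged**: the Deuring–Heilbronn phenomenon `deuring_heilbronn` holds — Bombieri's
Théorème 14, second assertion (`LogFreeDensity.logFreeDensityDH`), specialised to one zero
(`deuring_heilbronn_of_logFreeDensityDH_half`).
[cite: Bombieri1987GrandCrible, §6 Théorème 14] [cite: Linnik1944] -/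
theorem deuring_heilbronn_holds : deuring_heilbronn :=
  deuring_heilbronn_of_logFreeDensityDH_half LogFreeDensity.logFreeDensityDH

end Literature.NumberTheory.LFunctions
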